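import Literature.MathematicalPhysics.QuantumLattice.PairCorrelationsProofs
import Literature.MathematicalPhysics.QuantumLattice.HubbardWave0RayleighProofs
import HarnessLib

/-!
# Yang's bound for Scalapino's pair field: `⟨Δ_g† Δ_g⟩ ≤ N(2L² - N + 2)/2 · ‖g‖²` on `N`-particle torus states

Proof-only companion of `PairCorrelations` / `PairCorrelationsProofs` (the pair field
`Δ_g = Σ_x P_x` of an even form factor `g` on the fermionic torus `(ℤ/Lℤ)²`, its pair
wavefunction `φ_g` with `Δ_g = P_{φ_g}`, Yang's identity `⟨Δ_g† Δ_g⟩ = φ_g† ρ₂ φ_g`) and of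
`HubbardWave0RayleighProofs` (Yang's bound `Re ⟨v, ρ₂ v⟩ ≤ N(M - N + 2)/M · ‖v‖²`,
`twoParticleRDM_rayleigh_le_holds`). It combines them into the sharp universal ceiling on the
summit functional of `HubbardSuperconductivity` (the `d_{x²-y²}` pair-field density
`L⁻⁴ ⟨Δ_d† Δ_d⟩`), valid for EVERY state of fixed particle number — ground state or not, any
Hamiltonian, any coupling:

* `PairFieldYang.torusProj_injOn_insert_zero_unitSteps` — for `L ≥ 3` the five steps `0, ±e₁, ±e₂` have
  pairwise distinct projections to `(ℤ/Lℤ)²`;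
* `norm_sq_pairFieldWavefunction_apply`, `sum_norm_sq_pairFieldWavefunction`,
  `re_star_pairFieldWavefunction_dotProduct_self` — hence the step components of `φ_g` have disjoint
  supports and `‖φ_g‖² = L² Σ_{e ∈ {0} ∪ unitSteps} g(e)²` (`= 4L²` for `g = dWaveFormFactor`,
  `PairFieldYang.sum_sq_dWaveFormFactor`, `re_star_pairFieldWavefunction_dWave_dotProduct_self`);
* `re_expect_pairField_conjTranspose_mul_le_yang` — **Yang's bound for the pair field**: for an
  even form factor `g`, `L ≥ 3`, `N` even, `N ≤ 2L²` and every `N`-particle Fock vector `ψ`,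
  `Re ⟨ψ, Δ_g† Δ_g ψ⟩ ≤ N(2L² - N + 2)/(2L²) · L² Σ_e g(e)² · ‖ψ‖²` (homogeneous in `ψ`);
* `re_expect_pairField_dWave_conjTranspose_mul_le_yang` — the `d`-wave case:
  `Re ⟨ψ, Δ_d† Δ_d ψ⟩ ≤ 2N(2L² - N + 2) ‖ψ‖²`. At filling `N = (1-δ)L²` this is
  `(2(1-δ²)L⁴ + O(L²)) ‖ψ‖²`: the pair-field density of any state of hole doping `δ` is at most
  `2(1 - δ²) + o(1)` — compare the crude operator-norm bound `32` (`‖Δ_d‖ ≤ 4√2 L²`).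

Sources: C. N. Yang, Rev. Mod. Phys. **34** (1962) 694, §3–§4 and Appendix A (the bound on the
largest eigenvalue of `ρ₂`, `λ ≤ N(M - N + 2)/M`, and the geminal identity eq. (22));
D. J. Scalapino, Phys. Rep. **250** (1995) 329, §2 eq. (2.2)–(2.4) (the `d_{x²-y²}` pair field).
Folklore finite-dimensional bookkeeping otherwise; no definition and no named fact is introduced.
-/

namespace Literature.MathematicalPhysics.QuantumLattice

open Matrix Finset
open Literature.Probability.LatticeModels
open scoped ComplexOrder

/-! ### The five steps are distinct on the torus of side `L ≥ 3` -/

namespace PairFieldYang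

/-- Membership in `{0} ∪ unitSteps`, unfolded. Scalapino, Phys. Rep. 250 (1995) 329, §2. [folklore] -/
theorem mem_insert_zero_unitSteps_iff (e : Site 2) :
    e ∈ insert (0 : Site 2) unitSteps ↔ e = 0 ∨ e = Pi.single 0 1 ∨ e = -Pi.single 0 1 ∨
      e = Pi.single 1 1 ∨ e = -Pi.single 1 1 := by
  simp [unitSteps]

/-- **For `L ≥ 3` the five steps `0, ±e₁, ±e₂` of `ℤ²` project to five distinct points of the torus
`(ℤ/Lℤ)²`** (`1 ≠ 0`, `-1 ≠ 0`, `1 ≠ -1` in `ZMod L`). Friedli–Velenik (2017) §3.1. [folklore] -/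
theorem torusProj_injOn_insert_zero_unitSteps {L : ℕ} (hL : 3 ≤ L) :
    Set.InjOn (Torus.proj L) ((insert (0 : Site 2) unitSteps : Finset (Site 2)) : Set (Site 2)) := by
  -- `1 ≠ 0`, `-1 ≠ 0`, `1 ≠ -1` in `ZMod L`
  have h10 : (1 : ZMod L) ≠ 0 := by
    intro h
    have h' : ((1 : ℕ) : ZMod L) = 0 := by rw [Nat.cast_one, h]
    rw [ZMod.natCast_eq_zero_iff] at h'
    have := Nat.le_of_dvd one_pos h'
    omega
  have hm10 : (-1 : ZMod L) ≠ 0 := fun h => h10 (neg_eq_zero.1 h)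
  have h1m1 : (1 : ZMod L) ≠ -1 := by
    haveI : Fact (2 < L) := ⟨hL⟩
    exact fun h => ZMod.neg_one_ne_one h.symm
  intro e he e' he' h
  have h0 := congr_fun h 0
  have h1 := congr_fun h 1
  simp only [Torus.proj_apply] at h0 h1
  rw [Finset.mem_coe, mem_insert_zero_unitSteps_iff] at he he'
  rcases he with rfl | rfl | rfl | rfl | rfl <;> rcases he' with rfl | rfl | rfl | rfl | rfl <;>
    first
    | rfl
    | (exfalso; simp at h0 h1; first
        | exact h10 h0 | exact h10 h0.symm | exact hm10 h0 | exact hm10 h0.symm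
        | exact h1m1 h0 | exact h1m1 h0.symm
        | exact h10 h1 | exact h10 h1.symm | exact hm10 h1 | exact hm10 h1.symm
        | exact h1m1 h1 | exact h1m1 h1.symm)

/-- There are four unit steps. Scalapino, Phys. Rep. 250 (1995) 329, §2. [folklore] -/
theorem card_unitSteps_eq_four : (unitSteps).card = 4 := by
  decide

/-- `g_d(e)² = 1` on the four unit steps. Scalapino, Phys. Rep. 250 (1995) 329, §2 eq. (2.3). [folklore] -/
theorem sq_dWaveFormFactor_of_mem_unitSteps {e : Site 2} (he : e ∈ unitSteps) :
    dWaveFormFactor e ^ 2 = 1 := by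
  simp only [unitSteps, Finset.mem_insert, Finset.mem_singleton] at he
  rcases he with rfl | rfl | rfl | rfl
  · rw [dWaveFormFactor, if_pos (Or.inl rfl)]; norm_num
  · rw [dWaveFormFactor, if_pos (Or.inr rfl)]; norm_num
  · rw [dWaveFormFactor, if_neg (by decide), if_pos (Or.inl rfl)]; norm_num
  · rw [dWaveFormFactor, if_neg (by decide), if_pos (Or.inr rfl)]; norm_num

/-- **`Σ_{e ∈ {0} ∪ unitSteps} g_d(e)² = 4`.** Scalapino, Phys. Rep. 250 (1995) 329, §2 eq. (2.3). [folklore] -/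
theorem sum_sq_dWaveFormFactor :
    ∑ e ∈ insert (0 : Site 2) unitSteps, dWaveFormFactor e ^ 2 = 4 := by
  rw [Finset.sum_insert (by decide : (0 : Site 2) ∉ unitSteps), dWaveFormFactor_zero]
  rw [Finset.sum_congr rfl fun e he => sq_dWaveFormFactor_of_mem_unitSteps he,
    Finset.sum_const, card_unitSteps_eq_four]
  norm_num

end PairFieldYang

/-! ### The norm of the pair wavefunction `φ_g` -/

section Wavefunction

variable (g : Site 2 → ℝ) (L : ℕ) [NeZero L]

omit [NeZero L] in
/-- Pointwise: for `L ≥ 3` at most ONE step `e` has `x₂ = x₁ + e` on the torus, so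
`|φ_g(o₁, o₂)|² = Σ_e [x₂ = x₁ + e] · (g(e)²/2) · [σ₁ ≠ σ₂]` — the step components of `φ_g` have
pairwise disjoint supports. Scalapino, Phys. Rep. 250 (1995) 329, §2 eq. (2.2)–(2.3). [folklore] -/
theorem norm_sq_pairFieldWavefunction_apply (hL : 3 ≤ L)
    (p : Orb (FermionTorus 2 L) × Orb (FermionTorus 2 L)) :
    ‖pairFieldWavefunction g L p‖ ^ 2 =
      ∑ e ∈ insert (0 : Site 2) unitSteps,
        if (ofLex p.2).1.toTorusSite = (ofLex p.1).1.toTorusSite + Torus.proj L e then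
          (if (ofLex p.1).2 = 0 ∧ (ofLex p.2).2 = 1 then g e ^ 2 / 2
            else if (ofLex p.1).2 = 1 ∧ (ofLex p.2).2 = 0 then g e ^ 2 / 2 else 0)
        else 0 := by
  have hs2 : Real.sqrt 2 ^ 2 = 2 := Real.sq_sqrt (by norm_num)
  have hval : ∀ e : Site 2, ‖((g e / Real.sqrt 2 : ℝ) : ℂ)‖ ^ 2 = g e ^ 2 / 2 := by
    intro e
    rw [Complex.norm_real, Real.norm_eq_abs, sq_abs, div_pow, hs2]
  unfold pairFieldWavefunction
  by_cases hex : ∃ e ∈ insert (0 : Site 2) unitSteps,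
      (ofLex p.2).1.toTorusSite = (ofLex p.1).1.toTorusSite + Torus.proj L e
  · obtain ⟨e₀, he₀, hpe₀⟩ := hex
    -- only the step `e₀` matches
    have huniq : ∀ e ∈ insert (0 : Site 2) unitSteps, e ≠ e₀ →
        ¬ (ofLex p.2).1.toTorusSite = (ofLex p.1).1.toTorusSite + Torus.proj L e := by
      intro e he hne h
      apply hne
      refine PairFieldYang.torusProj_injOn_insert_zero_unitSteps hL (Finset.mem_coe.2 he)
        (Finset.mem_coe.2 he₀) ?_
      exact add_left_cancel (h.symm.trans hpe₀)
    rw [Finset.sum_eq_single_of_mem e₀ he₀ fun e he hne => if_neg (huniq e he hne),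
      Finset.sum_eq_single_of_mem e₀ he₀ fun e he hne => if_neg (huniq e he hne),
      if_pos hpe₀, if_pos hpe₀]
    split_ifs
    · rw [norm_neg, hval]
    · rw [hval]
    · simp
  · push Not at hex
    rw [Finset.sum_eq_zero fun e he => if_neg (hex e he),
      Finset.sum_eq_zero fun e he => if_neg (hex e he)]
    simp

omit [NeZero L] in
/-- The cardinality of the torus `(ℤ/Lℤ)²` as a real number: `L²`. Friedli–Velenik (2017) §3.1. [folklore] -/
theorem PairFieldYang.card_torusSite_two_cast [NeZero L] : ((Fintype.card (TorusSite 2 L) : ℕ) : ℝ) = (L : ℝ) ^ 2 := by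
  rw [Fintype.card_fun, ZMod.card, Fintype.card_fin]
  push_cast
  ring

/-- **`Σ_p |φ_g(p)|² = L² Σ_e g(e)²` for `L ≥ 3`**: each step component contributes
`Σ_{x} (g(e)²/2 + g(e)²/2) = L² g(e)²` (two opposite-spin configurations per bond), and the
components have disjoint supports. Scalapino, Phys. Rep. 250 (1995) 329, §2 eq. (2.2)–(2.3). [folklore] -/
theorem sum_norm_sq_pairFieldWavefunction (hL : 3 ≤ L) :
    ∑ p : Orb (FermionTorus 2 L) × Orb (FermionTorus 2 L), ‖pairFieldWavefunction g L p‖ ^ 2 =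
      (L : ℝ) ^ 2 * ∑ e ∈ insert (0 : Site 2) unitSteps, g e ^ 2 := by
  simp only [norm_sq_pairFieldWavefunction_apply g L hL]
  rw [Finset.sum_comm, Finset.mul_sum]
  refine Finset.sum_congr rfl fun e _ => ?_
  rw [Fintype.sum_prod_type, sum_orb_fermionTorus]
  -- each site `x₁` contributes `g(e)²`
  have hx : ∀ x₁ : TorusSite 2 L, (∑ σ₁ : Fin 2, ∑ p₂ : Orb (FermionTorus 2 L),
      if (ofLex p₂).1.toTorusSite = (ofLex (orb (FermionTorus.ofTorusSite x₁) σ₁)).1.toTorusSite +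
          Torus.proj L e then
        (if (ofLex (orb (FermionTorus.ofTorusSite x₁) σ₁)).2 = 0 ∧ (ofLex p₂).2 = 1 then g e ^ 2 / 2
          else if (ofLex (orb (FermionTorus.ofTorusSite x₁) σ₁)).2 = 1 ∧ (ofLex p₂).2 = 0 then
            g e ^ 2 / 2 else 0)
      else (0 : ℝ)) = g e ^ 2 := by
    intro x₁
    simp only [sum_orb_fermionTorus (d := 2) (L := L), ofLex_toLex,
      FermionTorus.toTorusSite_ofTorusSite, Fin.sum_univ_two, Fin.isValue]
    simp only [true_and, and_true, zero_ne_one, one_ne_zero, and_self, if_true, if_false, ite_self,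
      add_zero, zero_add, Finset.sum_ite_eq', Finset.mem_univ]
    ring
  rw [Finset.sum_congr rfl fun x₁ _ => hx x₁, Finset.sum_const, Finset.card_univ, nsmul_eq_mul,
    PairFieldYang.card_torusSite_two_cast]

/-- **`‖φ_g‖² = L² Σ_e g(e)²`** (`L ≥ 3`), as the real part of `φ_g† φ_g`.
Scalapino, Phys. Rep. 250 (1995) 329, §2. [folklore] -/
theorem re_star_pairFieldWavefunction_dotProduct_self (hL : 3 ≤ L) :
    (star (pairFieldWavefunction g L) ⬝ᵥ pairFieldWavefunction g L).re =
      (L : ℝ) ^ 2 * ∑ e ∈ insert (0 : Site 2) unitSteps, g e ^ 2 := by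
  rw [Matrix.star_dotProduct_self_eq_ofReal, Complex.ofReal_re, sum_norm_sq_pairFieldWavefunction g L hL]

/-- **`‖φ_d‖² = 4L²`** (`L ≥ 3`). Scalapino, Phys. Rep. 250 (1995) 329, §2 eq. (2.3). [folklore] -/
theorem re_star_pairFieldWavefunction_dWave_dotProduct_self (hL : 3 ≤ L) :
    (star (pairFieldWavefunction dWaveFormFactor L) ⬝ᵥ pairFieldWavefunction dWaveFormFactor L).re =
      4 * (L : ℝ) ^ 2 := by
  rw [re_star_pairFieldWavefunction_dotProduct_self dWaveFormFactor L hL, PairFieldYang.sum_sq_dWaveFormFactor]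
  ring

end Wavefunction

/-! ### Yang's bound for the pair field -/

section Yang

variable (g : Site 2 → ℝ) (L : ℕ) [NeZero L]

/-- Scaling of expectations: `⟨aψ, A (aψ)⟩ = ā a ⟨ψ, A ψ⟩`. Yang, Rev. Mod. Phys. 34 (1962) 694, §3. [folklore] -/
theorem PairFieldYang.expect_smul_vec_eq {ι : Type*} [Fintype ι] (a : ℂ) (A : Matrix (Finset ι) (Finset ι) ℂ)
    (ψ : Fock ι) : expect A (a • ψ) = star a * a * expect A ψ := by
  simp only [expect, mulVec_smul, star_smul, smul_dotProduct, dotProduct_smul, smul_eq_mul]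
  ring

/-- **Yang's bound for the pair field of an even form factor** (`g (-e) = g e`, `L ≥ 3`): for every
`N`-particle Fock vector `ψ` on the torus of side `L`, `N` even, `N ≤ 2L²`,
`Re ⟨ψ, Δ_g† Δ_g ψ⟩ ≤ N(2L² - N + 2)/(2L²) · (L² Σ_e g(e)²) · ‖ψ‖²`.
Proof: `⟨Δ_g† Δ_g⟩ = φ_g† ρ₂ φ_g` (`expect_pairField_eq_dotProduct_twoParticleRDM` with
`pairField_eq_pairAnnihilator_of_even` and Yang's identity), Yang's bound
`twoParticleRDM_rayleigh_le_holds` on the normalised state `ψ/‖ψ‖` (`M = 2L²` orbitals), and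
`‖φ_g‖² = L² Σ_e g(e)²`. Yang, Rev. Mod. Phys. 34 (1962) 694, §3–§4; Scalapino, Phys. Rep. 250
(1995) 329, §2. [folklore] -/
theorem re_expect_pairField_conjTranspose_mul_le_yang (hg : ∀ e, g (-e) = g e) (hL : 3 ≤ L)
    {N : ℕ} (hN : Even N) (hNL : N ≤ 2 * L ^ 2) {ψ : Fock (Orb (FermionTorus 2 L))}
    (hψ : IsNParticle N ψ) :
    (expect ((pairField g L)ᴴ * pairField g L) ψ).re ≤
      (N : ℝ) * (2 * (L : ℝ) ^ 2 - N + 2) / (2 * (L : ℝ) ^ 2) *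
        ((L : ℝ) ^ 2 * ∑ e ∈ insert (0 : Site 2) unitSteps, g e ^ 2) * (star ψ ⬝ᵥ ψ).re := by
  -- the squared norm of `ψ`
  have hr : star ψ ⬝ᵥ ψ = (((star ψ ⬝ᵥ ψ).re : ℝ) : ℂ) := by
    rw [Matrix.star_dotProduct_self_eq_ofReal, Complex.ofReal_re]
  set r : ℝ := (star ψ ⬝ᵥ ψ).re with hrdef
  have hr0 : 0 ≤ r := by
    rw [hrdef, Matrix.star_dotProduct_self_eq_ofReal, Complex.ofReal_re]
    exact Finset.sum_nonneg fun _ _ => by positivity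
  have hcardN : Fintype.card (Orb (FermionTorus 2 L)) = 2 * L ^ 2 := by
    rw [card_orb]; simp [FermionTorus, Fintype.card_lex]
  have hcard : (Fintype.card (Orb (FermionTorus 2 L)) : ℝ) = 2 * (L : ℝ) ^ 2 := by
    rw [hcardN]; push_cast; ring
  rcases hr0.eq_or_lt with hr00 | hrpos
  · -- `ψ = 0`
    have hψ0 : ψ = 0 := by
      have h := hr
      rw [← hr00, Complex.ofReal_zero, Matrix.star_dotProduct_self_eq_ofReal,
        Complex.ofReal_eq_zero] at h
      funext s
      have hs := (Finset.sum_eq_zero_iff_of_nonneg fun s _ => by positivity).1 h s (Finset.mem_univ _)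
      exact norm_eq_zero.1 (pow_eq_zero_iff two_ne_zero |>.1 hs)
    subst hψ0
    simp [expect, ← hr00]
  · -- normalise and apply Yang's bound
    set a : ℝ := (Real.sqrt r)⁻¹ with ha
    have hsq : Real.sqrt r ^ 2 = r := Real.sq_sqrt hr0
    have hsr : 0 < Real.sqrt r := Real.sqrt_pos.2 hrpos
    have haa : a * a * r = 1 := by
      rw [ha, ← mul_inv, Real.mul_self_sqrt hr0, inv_mul_cancel₀ hrpos.ne']
    set ψ₁ : Fock (Orb (FermionTorus 2 L)) := (a : ℂ) • ψ with hψ₁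
    have hψ₁N : IsNParticle N ψ₁ := fun s hs => by
      simp only [hψ₁, Pi.smul_apply, hψ s hs, smul_zero]
    have hnorm₁ : star ψ₁ ⬝ᵥ ψ₁ = 1 := by
      simp only [hψ₁, star_smul, smul_dotProduct, dotProduct_smul, smul_eq_mul]
      rw [hr, Complex.star_def, Complex.conj_ofReal]
      have : ((a : ℂ) * ((a : ℂ) * (r : ℂ))) = ((a * a * r : ℝ) : ℂ) := by push_cast; ring
      rw [this, haa]; simp
    have hY := twoParticleRDM_rayleigh_le_holds (ι := Orb (FermionTorus 2 L)) N hN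
      (by rw [hcardN]; exact hNL) ψ₁ hψ₁N hnorm₁ (pairFieldWavefunction g L)
    rw [← expect_pairField_eq_dotProduct_twoParticleRDM g L expect_pairAnnihilator_conjTranspose_mul_holds
      (pairField_eq_pairAnnihilator_of_even g L hg), hcard,
      re_star_pairFieldWavefunction_dotProduct_self g L hL] at hY
    -- `expect _ ψ₁ = a² expect _ ψ`
    have hscale : expect ((pairField g L)ᴴ * pairField g L) ψ₁ =
        (((a * a : ℝ)) : ℂ) * expect ((pairField g L)ᴴ * pairField g L) ψ := by
      rw [hψ₁, PairFieldYang.expect_smul_vec_eq, Complex.star_def, Complex.conj_ofReal]; push_cast; ring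
    rw [hscale, Complex.re_ofReal_mul] at hY
    -- multiply Yang's bound by `r` and use `a² r = 1`
    have hE : (expect ((pairField g L)ᴴ * pairField g L) ψ).re =
        r * (a * a * (expect ((pairField g L)ᴴ * pairField g L) ψ).re) := by
      calc (expect ((pairField g L)ᴴ * pairField g L) ψ).re
          = (a * a * r) * (expect ((pairField g L)ᴴ * pairField g L) ψ).re := by rw [haa, one_mul]
        _ = _ := by ring
    rw [hE]
    have hcoef : 0 ≤ (N : ℝ) * (2 * (L : ℝ) ^ 2 - N + 2) / (2 * (L : ℝ) ^ 2) *
        ((L : ℝ) ^ 2 * ∑ e ∈ insert (0 : Site 2) unitSteps, g e ^ 2) := by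
      have hNL' : (N : ℝ) ≤ 2 * (L : ℝ) ^ 2 := by exact_mod_cast hNL
      have : 0 ≤ 2 * (L : ℝ) ^ 2 - N + 2 := by linarith
      have hsum : 0 ≤ ∑ e ∈ insert (0 : Site 2) unitSteps, g e ^ 2 :=
        Finset.sum_nonneg fun _ _ => by positivity
      positivity
    calc r * (a * a * (expect ((pairField g L)ᴴ * pairField g L) ψ).re)
        ≤ r * ((N : ℝ) * (2 * (L : ℝ) ^ 2 - N + 2) / (2 * (L : ℝ) ^ 2) *
            ((L : ℝ) ^ 2 * ∑ e ∈ insert (0 : Site 2) unitSteps, g e ^ 2)) :=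
          mul_le_mul_of_nonneg_left hY hr0
      _ = _ := by ring

/-- **Yang's bound for the `d_{x²-y²}` pair field**: for `L ≥ 3`, `N` even, `N ≤ 2L²` and every
`N`-particle Fock vector `ψ` on the torus of side `L`,
`Re ⟨ψ, Δ_d† Δ_d ψ⟩ ≤ 2N(2L² - N + 2) · ‖ψ‖²` (`‖φ_d‖² = 4L²`). At `N ≈ (1-δ)L²` the right-hand
side is `(2(1 - δ²) L⁴ + O(L²)) ‖ψ‖²`: the `d`-wave pair-field density of ANY state of hole doping
`δ` is at most `2(1 - δ²) + o(1)`. Yang, Rev. Mod. Phys. 34 (1962) 694, §3–§4; Scalapino,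
Phys. Rep. 250 (1995) 329, §2 eq. (2.4). [folklore] -/
theorem re_expect_pairField_dWave_conjTranspose_mul_le_yang (hL : 3 ≤ L) {N : ℕ} (hN : Even N)
    (hNL : N ≤ 2 * L ^ 2) {ψ : Fock (Orb (FermionTorus 2 L))} (hψ : IsNParticle N ψ) :
    (expect ((pairField dWaveFormFactor L)ᴴ * pairField dWaveFormFactor L) ψ).re ≤
      2 * (N : ℝ) * (2 * (L : ℝ) ^ 2 - N + 2) * (star ψ ⬝ᵥ ψ).re := by
  have h := re_expect_pairField_conjTranspose_mul_le_yang dWaveFormFactor L dWaveFormFactor_neg hL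
    hN hNL hψ
  rw [PairFieldYang.sum_sq_dWaveFormFactor] at h
  have hL0 : (0 : ℝ) < (L : ℝ) ^ 2 := by
    have : (0 : ℝ) < (L : ℝ) := by exact_mod_cast Nat.pos_of_ne_zero (NeZero.ne L)
    positivity
  have hcoef : (N : ℝ) * (2 * (L : ℝ) ^ 2 - N + 2) / (2 * (L : ℝ) ^ 2) * ((L : ℝ) ^ 2 * 4) =
      2 * (N : ℝ) * (2 * (L : ℝ) ^ 2 - N + 2) := by
    field_simp
    ring
  rwa [hcoef] at h

end Yang

end Literature.MathematicalPhysics.QuantumLattice
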